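import Summits.AtomisticToContinuum.BoseEinsteinCondensation.Theorems.BECRieszReverseHolderCoarseGrainedReverseHolderShadowInsertionSqLeTwoPinned
import HarnessLib

/-!
# Shadow certification T2: two-pinned cube sums ≤ the smooth structure factor (route BECRieszReverseHolder)

Line `registered` of crux stmt-AtomisticToContinuum-12840 (`CoarseGrainedReverseHolder`); registered
sub-goal `shadow_twoPinned_le_structureFactor` (T2 of the certification of the coarse RH₂/variance
functional on the shadow/Jastrow state of the smeared Riesz-2 gas; T1 is
`shadow_insertionSq_le_twoPinned`).

With `g = periodicRieszKernel 2 L η`, `H_N(Y) = Σ_{i<j} g(Y_i - Y_j)`, `b ≥ 0`, the torus cell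
`[0,L)³` cut into the `m³` cubes `Q_k` of side `ℓ = L/m` (`m ≥ 1`), `s = ℓ²` and
`Θ_{L,s} = periodicHeatSum L s` (the periodised heat kernel minus its mean `L⁻³`), we prove
`Σ_k ∫_{Q_k}∫_{Q_k}∫_{cell^n} e^{-bH_{n+2}(y :: y' :: X)} dX dy' dy
   ≤ κ ℓ³ / ((n+2)(n+1)) ∫_{cell^{n+2}} e^{-bH_{n+2}(Y)} (Σ_aΣ_c Θ_{L,s}(Y_a - Y_c) + (n+2)²/L³) dY`
with the absolute constant `κ = (4π)^{3/2} e^{3/4}`.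

Proof. (1) UNFOLD (`setIntegral_twoPinned_eq`): `Q_k ⊆ cell`, so by Fubini along `vecCons` twice
each cube term is `∫_{cell^{n+2}} 1_{Q_k}(Y₀) 1_{Q_k}(Y₁) e^{-bH_{n+2}(Y)} dY`; sum over `k` inside.
(2) POINTWISE (`sum_indicator_mul_indicator_le`): the cubes are disjoint, so
`Σ_k 1_{Q_k}(y) 1_{Q_k}(y') ≤ 1` and it vanishes unless `‖y - y'‖² ≤ 3ℓ²`, where
`κ ℓ³ G_s(y - y') ≥ 1`; and `Θ_{L,s} + L⁻³ = Σ_{n ∈ ℤ³} G_s(· - Ln) ≥ G_s ≥ 0`.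
(3) SYMMETRISE (`mul_setIntegral_pair_le`): `H_{n+2}` is relabelling invariant (`g` even), so the
weighted integral of `P(Y_a - Y_c)`, `P = Θ_{L,s} + L⁻³ ≥ 0`, is the same for all ordered pairs
`a ≠ c`; adding the non-negative diagonal terms,
`(n+2)(n+1) ∫ P(Y₀ - Y₁) e^{-bH} ≤ ∫ (Σ_aΣ_c P(Y_a - Y_c)) e^{-bH}` and
`Σ_aΣ_c P = Σ_aΣ_c Θ_{L,s} + (n+2)²/L³`.
-/

namespace Summit.AtomisticToContinuum.BoseEinsteinCondensation.Theorems.CoarseGrainedReverseHolder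

open MeasureTheory
open Literature.MathematicalPhysics.QuantumManyBody
open Literature.MathematicalPhysics.StatisticalMechanics
open Literature.Analysis.UnboundedOperators
open BoseGas

namespace ShadowStructureFactor

variable {n : ℕ} {L : ℝ}

/-- Fubini on the cell, tagged coordinate outermost, for an integrand that is merely integrable on
`[0,L)^{3(N+1)}`: `∫_{[0,L)^{3(N+1)}} F = ∫_{[0,L)³} (∫_{[0,L)^{3N}} F(x :: Y) dY) dx`. -/
theorem setIntegral_cellN_succ_left_of_integrableOn {E : Type*} [NormedAddCommGroup E]
    [NormedSpace ℝ E] {N : ℕ} {F : Config (N + 1) → E}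
    (hF : IntegrableOn F (cellN (N + 1) L) volume) :
    ∫ X in cellN (N + 1) L, F X = ∫ x in cell L, ∫ Y in cellN N L, F (Matrix.vecCons x Y) := by
  -- adapted from `BoseGas.setIntegral_cellN_succ_left_of_continuous`
  have hint : Integrable (fun p : Space × Config N => F (Matrix.vecCons p.1 p.2))
      ((volume.restrict (cell L)).prod (volume.restrict (cellN N L))) := by
    have h := ((measurePreserving_vecCons (n := N)).integrableOn_comp_preimage
      measurableEmbedding_vecCons (f := F) (s := cellN (N + 1) L)).2 hF
    rw [vecCons_preimage_cellN] at h
    rw [Measure.prod_restrict]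
    exact h
  calc ∫ X in cellN (N + 1) L, F X
      = ∫ p in (fun p : Space × Config N => (Matrix.vecCons p.1 p.2 : Config (N + 1))) ⁻¹'
            cellN (N + 1) L, F (Matrix.vecCons p.1 p.2) ∂(volume.prod volume) :=
        ((measurePreserving_vecCons (n := N)).setIntegral_preimage_emb
          measurableEmbedding_vecCons F _).symm
    _ = ∫ p, F (Matrix.vecCons p.1 p.2)
          ∂((volume.restrict (cell L)).prod (volume.restrict (cellN N L))) := by
        rw [vecCons_preimage_cellN, Measure.prod_restrict]
    _ = ∫ x in cell L, ∫ Y in cellN N L, F (Matrix.vecCons x Y) :=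
        integral_prod (fun p : Space × Config N => F (Matrix.vecCons p.1 p.2)) hint

/-- A continuous integrand cut off by `1_Q(Y₀)` (`Q` measurable) is integrable on the cell. -/
theorem integrableOn_indicator_mul {N : ℕ} {Q : Set Space} (hQ : MeasurableSet Q)
    {F : Config (N + 1) → ℝ} (hF : Continuous F) :
    IntegrableOn (fun Y => Q.indicator (fun _ => (1 : ℝ)) (Y 0) * F Y) (cellN (N + 1) L)
      volume := by
  refine Integrable.mono (integrableOn_cellN hF L) ?_ (ae_of_all _ fun Y => ?_)
  · exact (((measurable_const.indicator hQ).comp (measurable_pi_apply 0)).mul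
      hF.measurable).aestronglyMeasurable
  · rw [norm_mul]
    refine mul_le_of_le_one_left (norm_nonneg (F Y)) ?_
    by_cases hY : Y 0 ∈ Q <;> simp [hY]

/-- A continuous integrand cut off by `1_Q(Y₀) 1_Q(Y₁)` (`Q` measurable) is integrable on the
cell. -/
theorem integrableOn_indicator_mul_indicator_mul {N : ℕ} {Q : Set Space} (hQ : MeasurableSet Q)
    {F : Config (N + 2) → ℝ} (hF : Continuous F) :
    IntegrableOn (fun Y => Q.indicator (fun _ => (1 : ℝ)) (Y 0) *
      (Q.indicator (fun _ => (1 : ℝ)) (Y 1) * F Y)) (cellN (N + 2) L) volume := by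
  refine Integrable.mono (integrableOn_cellN hF L) ?_ (ae_of_all _ fun Y => ?_)
  · exact (((measurable_const.indicator hQ).comp (measurable_pi_apply 0)).mul
      (((measurable_const.indicator hQ).comp (measurable_pi_apply 1)).mul
        hF.measurable)).aestronglyMeasurable
  · rw [norm_mul, norm_mul, ← mul_assoc]
    refine mul_le_of_le_one_left (norm_nonneg (F Y)) ?_
    by_cases hY : Y 0 ∈ Q <;> by_cases hY' : Y 1 ∈ Q <;> simp [hY, hY']

/-- Cutting off the first coordinate by `1_Q`, `Q ⊆ [0,L)³`, restricts its cell integral to `Q`. -/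
theorem setIntegral_cell_indicator_mul {Q : Set Space} (hQ : MeasurableSet Q) (hQL : Q ⊆ cell L)
    (f : Space → ℝ) :
    ∫ y in cell L, Q.indicator (fun _ => (1 : ℝ)) y * f y = ∫ y in Q, f y := by
  have h : (fun y => Q.indicator (fun _ => (1 : ℝ)) y * f y) = Q.indicator f := by
    funext y
    by_cases hy : y ∈ Q <;> simp [hy]
  rw [h, integral_indicator hQ, Measure.restrict_restrict hQ, Set.inter_eq_left.2 hQL]

/-- **Unfolding the two-pinned cube integral**: for a continuous `F` on `(ℝ³)^{n+2}` and a
measurable `Q ⊆ [0,L)³`,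
`∫_Q ∫_Q ∫_{[0,L)^{3n}} F(y :: y' :: X) dX dy' dy = ∫_{[0,L)^{3(n+2)}} 1_Q(Y₀) 1_Q(Y₁) F(Y) dY`. -/
theorem setIntegral_twoPinned_eq {Q : Set Space} (hQ : MeasurableSet Q) (hQL : Q ⊆ cell L)
    {F : Config (n + 2) → ℝ} (hF : Continuous F) :
    ∫ y in Q, ∫ y' in Q, ∫ X in cellN n L, F (Matrix.vecCons y (Matrix.vecCons y' X)) =
      ∫ Y in cellN (n + 2) L,
        Q.indicator (fun _ => (1 : ℝ)) (Y 0) * (Q.indicator (fun _ => (1 : ℝ)) (Y 1) * F Y) := by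
  rw [setIntegral_cellN_succ_left_of_integrableOn
      (integrableOn_indicator_mul_indicator_mul hQ hF), ← setIntegral_cell_indicator_mul hQ hQL]
  refine setIntegral_congr_fun (measurableSet_cell L) fun y _ => ?_
  simp only [Matrix.cons_val_zero, Matrix.cons_val_one]
  rw [integral_const_mul]
  congr 1
  have h2 : IntegrableOn (fun Z : Config (n + 1) =>
      Q.indicator (fun _ => (1 : ℝ)) (Z 0) * F (Matrix.vecCons y Z)) (cellN (n + 1) L) volume :=
    integrableOn_indicator_mul hQ (hF.comp (continuous_const.matrixVecCons continuous_id))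
  rw [setIntegral_cellN_succ_left_of_integrableOn h2, ← setIntegral_cell_indicator_mul hQ hQL]
  refine setIntegral_congr_fun (measurableSet_cell L) fun y' _ => ?_
  simp only [Matrix.cons_val_zero]
  rw [integral_const_mul]

/-! ### The cube overlap is dominated by a heat-kernel bump of the pair distance -/

/-- At the cube scale `ℓ`: `1 ≤ (4π)^{3/2} e^{3/4} ℓ³ G_{ℓ²}(z)` whenever `‖z‖² ≤ 3ℓ²`
(`G_{ℓ²}(z) = (4πℓ²)^{-3/2} e^{-‖z‖²/(4ℓ²)} ≥ (4π)^{-3/2} ℓ^{-3} e^{-3/4}`). -/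
theorem one_le_mul_heatKernel {ℓ : ℝ} (hℓ : 0 < ℓ) {z : Space} (hz : ‖z‖ ^ 2 ≤ 3 * ℓ ^ 2) :
    1 ≤ (4 * Real.pi) ^ ((3 : ℝ) / 2) * Real.exp (3 / 4) * ℓ ^ 3 * heatKernel (ℓ ^ 2) z := by
  have h4π : (0 : ℝ) < 4 * Real.pi := by positivity
  have h3 : (ℓ ^ 2) ^ ((3 : ℝ) / 2) = ℓ ^ 3 := by
    rw [← Real.rpow_ofNat ℓ 2, ← Real.rpow_mul hℓ.le]
    norm_num
  have hpow : (4 * Real.pi * ℓ ^ 2) ^ (-(Module.finrank ℝ Space : ℝ) / 2) =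
      ((4 * Real.pi) ^ ((3 : ℝ) / 2) * ℓ ^ 3)⁻¹ := by
    rw [finrank_euclideanSpace_fin, Nat.cast_ofNat, neg_div, Real.rpow_neg (by positivity),
      Real.mul_rpow h4π.le (by positivity), h3]
  have hexp : 1 ≤ Real.exp (3 / 4) * Real.exp (-‖z‖ ^ 2 / (4 * ℓ ^ 2)) := by
    rw [← Real.exp_add]
    refine Real.one_le_exp ?_
    rw [neg_div, ← sub_eq_add_neg, sub_nonneg, div_le_iff₀ (by positivity)]
    linarith
  unfold heatKernel
  rw [hpow]
  calc (1 : ℝ) ≤ Real.exp (3 / 4) * Real.exp (-‖z‖ ^ 2 / (4 * ℓ ^ 2)) := hexp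
    _ = _ := by field_simp

/-- **The cube overlap is dominated by a heat-kernel bump.** For the `m³` cubes `Q_k` of side
`ℓ = L/m` (`m ≥ 1`) and `s = ℓ²`:
`Σ_k 1_{Q_k}(y) 1_{Q_k}(y') ≤ (4π)^{3/2} e^{3/4} ℓ³ (Θ_{L,s}(y - y') + L⁻³)` — the cubes are
disjoint, so the left side vanishes unless `y, y'` share a cube (then it is `1` and
`‖y - y'‖² ≤ 3ℓ²`), while `Θ_{L,s} + L⁻³ = Σ_{n ∈ ℤ³} G_s(· - Ln) ≥ G_s`. -/
theorem sum_indicator_mul_indicator_le (hL : 0 < L) {m : ℕ} (hm : 1 ≤ m) (y y' : Space) :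
    ∑ k : Fin 3 → Fin m, (subCell (L / m) k).indicator (fun _ => (1 : ℝ)) y *
        (subCell (L / m) k).indicator (fun _ => (1 : ℝ)) y' ≤
      (4 * Real.pi) ^ ((3 : ℝ) / 2) * Real.exp (3 / 4) * (L / m) ^ 3 *
        (periodicHeatSum L ((L / m) ^ 2) (y - y') + 1 / L ^ 3) := by
  set ℓ : ℝ := L / m with hℓdef
  have hm0 : (0 : ℝ) < m := by exact_mod_cast hm
  have hℓ : 0 < ℓ := div_pos hL hm0
  have hs : 0 < ℓ ^ 2 := pow_pos hℓ 2
  -- the periodised heat sum plus its mean is the full lattice sum, at least its `n = 0` term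
  have hP : heatKernel (ℓ ^ 2) (y - y') ≤ periodicHeatSum L (ℓ ^ 2) (y - y') + 1 / L ^ 3 := by
    rw [periodicHeatSum, sub_add_cancel]
    have h := (summable_heatKernel_sub_latticeVec hL hs (y - y')).le_tsum 0
      (fun mm _ => (heatKernel_pos hs _).le)
    rwa [latticeVec_zero, sub_zero] at h
  have hK0 : 0 ≤ (4 * Real.pi) ^ ((3 : ℝ) / 2) * Real.exp (3 / 4) * ℓ ^ 3 := by positivity
  by_cases hex : ∃ k : Fin 3 → Fin m, y ∈ subCell ℓ k ∧ y' ∈ subCell ℓ k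
  · obtain ⟨k, hy, hy'⟩ := hex
    -- `y, y'` share the cube `Q_k`: the sum is `1` and `‖y - y'‖² ≤ 3ℓ²`
    have hsum : ∑ k' : Fin 3 → Fin m, (subCell ℓ k').indicator (fun _ => (1 : ℝ)) y *
        (subCell ℓ k').indicator (fun _ => (1 : ℝ)) y' = 1 := by
      rw [Finset.sum_eq_single k (fun k' _ hk' => ?_) (fun h => absurd (Finset.mem_univ _) h)]
      · rw [Set.indicator_of_mem hy, Set.indicator_of_mem hy', one_mul]
      · rw [Set.indicator_of_notMem (not_mem_subCell_of_ne hℓ (Ne.symm hk') hy), zero_mul]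
    have hz : ‖y - y'‖ ^ 2 ≤ 3 * ℓ ^ 2 := by
      rw [EuclideanSpace.real_norm_sq_eq]
      have hi : ∀ i, (y - y') i ^ 2 ≤ ℓ ^ 2 := fun i => by
        obtain ⟨h1, h2⟩ := mem_subCell.1 hy i
        obtain ⟨h3, h4⟩ := mem_subCell.1 hy' i
        rw [PiLp.sub_apply]
        exact sq_le_sq' (by linarith) (by linarith)
      calc ∑ i, (y - y') i ^ 2 ≤ ∑ _i : Fin 3, ℓ ^ 2 := Finset.sum_le_sum fun i _ => hi i
        _ = 3 * ℓ ^ 2 := by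
            rw [Finset.sum_const, Finset.card_univ, Fintype.card_fin, nsmul_eq_mul,
              Nat.cast_ofNat]
    rw [hsum]
    exact (one_le_mul_heatKernel hℓ hz).trans (mul_le_mul_of_nonneg_left hP hK0)
  · push Not at hex
    have hsum : ∑ k' : Fin 3 → Fin m, (subCell ℓ k').indicator (fun _ => (1 : ℝ)) y *
        (subCell ℓ k').indicator (fun _ => (1 : ℝ)) y' = 0 := by
      refine Finset.sum_eq_zero fun k' _ => ?_
      by_cases hy : y ∈ subCell ℓ k'
      · rw [Set.indicator_of_notMem (hex k' hy), mul_zero]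
      · rw [Set.indicator_of_notMem hy, zero_mul]
    rw [hsum]
    exact mul_nonneg hK0 ((heatKernel_pos hs _).le.trans hP)

/-! ### Relabelling symmetry spreads the tagged pair over all ordered pairs -/

/-- **Relabelling**: for a permutation-invariant weight `w` on `[0,L)^{3(n+2)}`, the pair
observable `P(Y_a - Y_c)` has the same cell integral against `w` for every ordered pair `a ≠ c`
(the permutation `σ = (0 a)(1 c')`, `c' = (0 a) c`, sends `0 ↦ a`, `1 ↦ c`). -/
theorem setIntegral_pair_eq (P : Space → ℝ) (w : Config (n + 2) → ℝ)
    (hw : ∀ (σ : Equiv.Perm (Fin (n + 2))) (Y : Config (n + 2)), w (Y ∘ σ) = w Y)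
    {a c : Fin (n + 2)} (hac : a ≠ c) :
    ∫ Y in cellN (n + 2) L, P (Y a - Y c) * w Y =
      ∫ Y in cellN (n + 2) L, P (Y 0 - Y 1) * w Y := by
  set σ : Equiv.Perm (Fin (n + 2)) := Equiv.swap 0 a * Equiv.swap 1 (Equiv.swap 0 a c) with hσ
  have hc' : (0 : Fin (n + 2)) ≠ Equiv.swap 0 a c := by
    intro h
    have : c = a := by rw [← Equiv.swap_apply_self 0 a c, ← h, Equiv.swap_apply_left]
    exact hac this.symm
  have h0 : σ 0 = a := by
    rw [hσ, Equiv.Perm.mul_apply, Equiv.swap_apply_of_ne_of_ne zero_ne_one hc',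
      Equiv.swap_apply_left]
  have h1 : σ 1 = c := by
    rw [hσ, Equiv.Perm.mul_apply, Equiv.swap_apply_left, Equiv.swap_apply_self]
  rw [← RieszFieldMoment.setIntegral_cellN_comp_perm σ (fun Y => P (Y 0 - Y 1) * w Y)]
  refine setIntegral_congr_fun (measurableSet_cellN _ L) fun Y _ => ?_
  simp only [Function.comp_apply, h0, h1, hw]

/-- **Spreading the tagged pair over all ordered pairs**: for continuous `P, w ≥ 0` with `w`
permutation invariant, `(n+2)(n+1) ∫ P(Y₀ - Y₁) w ≤ ∫ (Σ_a Σ_c P(Y_a - Y_c)) w` on `[0,L)^{3(n+2)}`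
(each off-diagonal ordered pair contributes the same, the diagonal ones are non-negative). -/
theorem mul_setIntegral_pair_le (P : Space → ℝ) (hP : Continuous P) (hP0 : ∀ z, 0 ≤ P z)
    (w : Config (n + 2) → ℝ) (hw : Continuous w) (hw0 : ∀ Y, 0 ≤ w Y)
    (hsymm : ∀ (σ : Equiv.Perm (Fin (n + 2))) (Y : Config (n + 2)), w (Y ∘ σ) = w Y) :
    ((n : ℝ) + 2) * ((n : ℝ) + 1) * ∫ Y in cellN (n + 2) L, P (Y 0 - Y 1) * w Y ≤
      ∫ Y in cellN (n + 2) L,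
        (∑ a : Fin (n + 2), ∑ c : Fin (n + 2), P (Y a - Y c)) * w Y := by
  set J : ℝ := ∫ Y in cellN (n + 2) L, P (Y 0 - Y 1) * w Y with hJ
  have hint : ∀ a c : Fin (n + 2), IntegrableOn (fun Y : Config (n + 2) => P (Y a - Y c) * w Y)
      (cellN (n + 2) L) volume := fun a c =>
    integrableOn_cellN ((hP.comp ((continuous_apply a).sub (continuous_apply c))).mul hw) L
  have hrow : ∀ a : Fin (n + 2),
      ((n : ℝ) + 1) * J ≤ ∑ c : Fin (n + 2), ∫ Y in cellN (n + 2) L, P (Y a - Y c) * w Y := by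
    intro a
    rw [Fin.sum_univ_succAbove _ a]
    have hdiag : 0 ≤ ∫ Y in cellN (n + 2) L, P (Y a - Y a) * w Y :=
      setIntegral_nonneg (measurableSet_cellN _ L) fun Y _ => mul_nonneg (hP0 _) (hw0 Y)
    have hoff : ∑ j : Fin (n + 1), ∫ Y in cellN (n + 2) L, P (Y a - Y (a.succAbove j)) * w Y =
        ((n : ℝ) + 1) * J := by
      rw [Finset.sum_congr rfl fun j _ =>
          setIntegral_pair_eq P w hsymm (Fin.succAbove_ne a j).symm,
        Finset.sum_const, Finset.card_univ, Fintype.card_fin, nsmul_eq_mul]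
      push_cast
      ring
    linarith
  calc ((n : ℝ) + 2) * ((n : ℝ) + 1) * J = ∑ _a : Fin (n + 2), ((n : ℝ) + 1) * J := by
        rw [Finset.sum_const, Finset.card_univ, Fintype.card_fin, nsmul_eq_mul]
        push_cast
        ring
    _ ≤ ∑ a : Fin (n + 2), ∑ c : Fin (n + 2), ∫ Y in cellN (n + 2) L, P (Y a - Y c) * w Y :=
        Finset.sum_le_sum fun a _ => hrow a
    _ = ∫ Y in cellN (n + 2) L, ∑ a : Fin (n + 2), ∑ c : Fin (n + 2), P (Y a - Y c) * w Y := by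
        rw [integral_finsetSum _ fun a _ => integrable_finsetSum _ fun c _ => hint a c]
        refine Finset.sum_congr rfl fun a _ => ?_
        rw [integral_finsetSum _ fun c _ => hint a c]
    _ = ∫ Y in cellN (n + 2) L, (∑ a : Fin (n + 2), ∑ c : Fin (n + 2), P (Y a - Y c)) * w Y := by
        refine integral_congr_ae (ae_of_all _ fun Y => ?_)
        simp only [Finset.sum_mul]

end ShadowStructureFactor

open ShadowStructureFactor in
/-- **Shadow certification, T2 (two-pinned cube sums ≤ smooth structure factor).** There is an
absolute `κ` (`= (4π)^{3/2} e^{3/4}`) such that for `g = periodicRieszKernel 2 L η`, `L > 0`,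
`b ≥ 0`, `η > 0`, `m ≥ 1` and every `n`, summing over the `m³` cubes `Q_k` of side `L/m` the
two-pinned partition functions `∫_{Q_k}∫_{Q_k}∫_{cell^n} e^{-bH_{n+2}(y :: y' :: X)}` gives at most
`κ (L/m)³/((n+2)(n+1)) ∫_{cell^{n+2}} e^{-bH_{n+2}} (Σ_iΣ_j Θ_{L,(L/m)²}(Y_i - Y_j) + (n+2)²/L³)`. -/
theorem shadow_twoPinned_le_structureFactor : ∃ κ : ℝ, ∀ (n m : ℕ) (L b η : ℝ), 0 < L → 0 ≤ b → 0 < η → 1 ≤ m → ∀ g : BoseGas.Space → ℝ, g = periodicRieszKernel 2 L η → ∑ k : Fin 3 → Fin m, ∫ y in {y : EuclideanSpace ℝ (Fin 3) | ∀ i, y i ∈ Set.Ico ((k i : ℝ) * (L / m)) (((k i : ℝ) + 1) * (L / m))}, ∫ y' in {y : EuclideanSpace ℝ (Fin 3) | ∀ i, y i ∈ Set.Ico ((k i : ℝ) * (L / m)) (((k i : ℝ) + 1) * (L / m))}, ∫ X in BoseGas.cellN n L, Real.exp (-(b * ∑ i : Fin (n + 2), ∑ j : Fin (n + 2) with i <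 j, g (Matrix.vecCons y (Matrix.vecCons y' X) i - Matrix.vecCons y (Matrix.vecCons y' X) j))) ≤ κ * (L / m) ^ 3 / (((n : ℝ) + 2) * ((n : ℝ) + 1)) * ∫ Y in BoseGas.cellN (n + 2) L, Real.exp (-(b * ∑ i : Fin (n + 2), ∑ j : Fin (n + 2) with i < j, g (Y i - Y j))) * (∑ i : Fin (n + 2), ∑ j : Fin (n + 2), periodicHeatSum L ((L / m) ^ 2) (Y i - Y j) + ((n : ℝ) + 2) ^ 2 / L ^ 3) := by
  refine ⟨(4 * Real.pi) ^ ((3 : ℝ) / 2) * Real.exp (3 / 4), ?_⟩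
  intro n m L b η hL hb hη hm g hg
  have hη' : η ≠ 0 := hη.ne'
  have hm0 : (0 : ℝ) < m := by exact_mod_cast hm
  have hℓ : 0 < L / m := div_pos hL hm0
  have hgc : Continuous g := by rw [hg]; exact continuous_periodicRieszKernel 2 hL hη'
  have heven : ∀ z, g (-z) = g z := fun z => by rw [hg]; exact periodicRieszKernel_neg 2 L η z
  -- notation: the Gibbs weight `F`, the bump `P = Θ_{L,s} + L⁻³`, the constant `K = κ ℓ³`
  set F : Config (n + 2) → ℝ := fun Y =>
    Real.exp (-(b * ∑ i : Fin (n + 2), ∑ j : Fin (n + 2) with i < j, g (Y i - Y j))) with hF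
  set P : Space → ℝ := fun z => periodicHeatSum L ((L / m) ^ 2) z + 1 / L ^ 3 with hP
  set K : ℝ := (4 * Real.pi) ^ ((3 : ℝ) / 2) * Real.exp (3 / 4) * (L / m) ^ 3 with hK
  have hFc : Continuous F :=
    Real.continuous_exp.comp (continuous_const.mul (continuous_finsetSum _ fun i _ =>
      continuous_finsetSum _ fun j _ =>
        hgc.comp ((continuous_apply i).sub (continuous_apply j)))).neg
  have hF0 : ∀ Y, 0 ≤ F Y := fun Y => (Real.exp_pos _).le
  have hFsymm : ∀ (σ : Equiv.Perm (Fin (n + 2))) (Y : Config (n + 2)), F (Y ∘ σ) = F Y := by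
    intro σ Y
    simp only [hF, RieszFieldMoment.pairSum_comp_perm g heven σ Y]
  have hPc : Continuous P := (continuous_periodicHeatSum hL (pow_pos hℓ 2)).add continuous_const
  have hP0 : ∀ z, 0 ≤ P z := fun z => by
    simp only [hP, periodicHeatSum, sub_add_cancel]
    exact tsum_nonneg fun mm => (heatKernel_pos (pow_pos hℓ 2) _).le
  have hK0 : 0 ≤ K := by positivity
  have hQ : ∀ k : Fin 3 → Fin m, subCell (L / m) k ⊆ cell L := fun k => by
    have h := subCell_subset_cell hℓ k
    rwa [show (m : ℝ) * (L / m) = L by field_simp] at h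
  simp only [CoarseRH2.setOf_forall_mem_Ico_eq_subCell]
  -- Step 1: unfold the cube terms and sum under the integral
  have lhs_eq : ∑ k : Fin 3 → Fin m, ∫ y in subCell (L / m) k, ∫ y' in subCell (L / m) k,
      ∫ X in cellN n L, F (Matrix.vecCons y (Matrix.vecCons y' X)) =
      ∫ Y in cellN (n + 2) L, (∑ k : Fin 3 → Fin m,
        (subCell (L / m) k).indicator (fun _ => (1 : ℝ)) (Y 0) *
          (subCell (L / m) k).indicator (fun _ => (1 : ℝ)) (Y 1)) * F Y := by
    rw [Finset.sum_congr rfl fun k _ =>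
      setIntegral_twoPinned_eq (measurableSet_subCell _ k) (hQ k) hFc,
      ← integral_finsetSum _ fun k _ =>
        integrableOn_indicator_mul_indicator_mul (measurableSet_subCell _ k) hFc]
    refine integral_congr_ae (ae_of_all _ fun Y => ?_)
    simp only [Finset.sum_mul, mul_assoc]
  -- Step 2: pointwise domination of the cube overlap by the bump
  have step2 : ∫ Y in cellN (n + 2) L, (∑ k : Fin 3 → Fin m,
        (subCell (L / m) k).indicator (fun _ => (1 : ℝ)) (Y 0) *
          (subCell (L / m) k).indicator (fun _ => (1 : ℝ)) (Y 1)) * F Y ≤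
      ∫ Y in cellN (n + 2) L, K * (P (Y 0 - Y 1) * F Y) := by
    refine integral_mono_of_nonneg (ae_of_all _ fun Y => ?_) ?_ (ae_of_all _ fun Y => ?_)
    · exact mul_nonneg (Finset.sum_nonneg fun k _ => mul_nonneg
        (Set.indicator_nonneg (fun _ _ => zero_le_one) _)
        (Set.indicator_nonneg (fun _ _ => zero_le_one) _)) (hF0 Y)
    · exact (integrableOn_cellN
        ((hPc.comp ((continuous_apply 0).sub (continuous_apply 1))).mul hFc) L).const_mul K
    · have h := sum_indicator_mul_indicator_le hL hm (Y 0) (Y 1)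
      calc _ ≤ K * P (Y 0 - Y 1) * F Y := mul_le_mul_of_nonneg_right h (hF0 Y)
        _ = _ := by ring
  -- Step 3: symmetrise over ordered pairs
  have step3 := mul_setIntegral_pair_le (L := L) P hPc hP0 F hFc hF0 hFsymm
  have hpos : (0 : ℝ) < ((n : ℝ) + 2) * ((n : ℝ) + 1) := by positivity
  have hJ : ∫ Y in cellN (n + 2) L, P (Y 0 - Y 1) * F Y ≤
      (∫ Y in cellN (n + 2) L, (∑ a : Fin (n + 2), ∑ c : Fin (n + 2), P (Y a - Y c)) * F Y) /
        (((n : ℝ) + 2) * ((n : ℝ) + 1)) := by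
    rw [le_div_iff₀ hpos]
    linarith
  -- Step 4: `Σ_aΣ_c P = Σ_aΣ_c Θ + (n+2)² / L³`
  have step4 :
      ∫ Y in cellN (n + 2) L, (∑ a : Fin (n + 2), ∑ c : Fin (n + 2), P (Y a - Y c)) * F Y =
        ∫ Y in cellN (n + 2) L, F Y * (∑ a : Fin (n + 2), ∑ c : Fin (n + 2),
        periodicHeatSum L ((L / m) ^ 2) (Y a - Y c) + ((n : ℝ) + 2) ^ 2 / L ^ 3) := by
    refine integral_congr_ae (ae_of_all _ fun Y => ?_)
    simp only [hP, Finset.sum_add_distrib, Finset.sum_const, Finset.card_univ, Fintype.card_fin,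
      nsmul_eq_mul]
    push_cast
    ring
  calc ∑ k : Fin 3 → Fin m, ∫ y in subCell (L / m) k, ∫ y' in subCell (L / m) k,
        ∫ X in cellN n L, F (Matrix.vecCons y (Matrix.vecCons y' X))
      = _ := lhs_eq
    _ ≤ _ := step2
    _ = K * ∫ Y in cellN (n + 2) L, P (Y 0 - Y 1) * F Y := integral_const_mul _ _
    _ ≤ K * ((∫ Y in cellN (n + 2) L,
          (∑ a : Fin (n + 2), ∑ c : Fin (n + 2), P (Y a - Y c)) * F Y) /
            (((n : ℝ) + 2) * ((n : ℝ) + 1))) := mul_le_mul_of_nonneg_left hJ hK0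
    _ = _ := by
        rw [step4, hK]
        ring

end Summit.AtomisticToContinuum.BoseEinsteinCondensation.Theorems.CoarseGrainedReverseHolder
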